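import Literature.NumberTheory.EllipticCurves.IwasawaAlgebraEisensteinQuotientDVRProofs
import Mathlib.GroupTheory.Torsion
import HarnessLib

/-!
# Torsion over Howard's Eisenstein quotients `S_m = Λ/(T^m + p)`: the `ℤ`-torsion of an `S_m`-module is its
# `S_m`-torsion; non-zero ideals have finite index; finitely generated torsion `S_m`-modules are finite, of
# order `p^{length}` (proofs file)

Topic `NumberTheory/EllipticCurves`. THEOREMS ONLY (no definition, no named fact, no instance, no `sorry`).
Sequel to `IwasawaAlgebraEisensteinQuotientDVRProofs` (`S_m` is a DVR with uniformiser `π`, `#κ = p`).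

WHAT (`m ≥ 1`, `S_m = IwasawaAlgebra p ⧸ Ideal.span {X^m + C p}`):
* §1 `finite_quotient_span_singleton_of_ne_zero` — every NON-ZERO principal ideal of `S_m` has finite index
  (`S_m/(s̄) = Λ/(s, q_m)` with `q_m ∤ s`), and `Module.finite_of_finite_quotient_of_le_annihilator` (any ring:
  a f.g. module killed by an ideal of finite index is finite);
* §2 `mem_addTorsion_iff_mem_torsion` — for ANY `S_m`-module `N`, the `ℤ`-torsion subgroup
  `AddCommGroup.torsion N` (the `Xq_tors` of the tree's `SpecWitness` interface) has the same elements as the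
  `S_m`-torsion submodule `Submodule.torsion S_m N` (`→`: `n • x = 0` with `0 < n`, and `(n : S_m) ≠ 0` since
  `S_m` has characteristic zero; `←`: `s • x = 0`, `s ≠ 0`, and `#(S_m/(s)) • 1 ∈ (s)`);
* §3 `finite_of_isTorsion` — a finitely generated TORSION `S_m`-module is finite; `finite_torsion`,
  `finite_addTorsion` — the torsion of a finitely generated `S_m`-module is finite; and
  `natCard_addTorsion_eq_pow_length` — `#N_tors = p^{ℓ_{S_m}(N_tors)}`.
* §4 (appended) `finite_quotient_span_singleton_of_linearEquiv`, `…_of_finrank_eq_one` — for a FREE RANK-ONE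
  `S_m`-module `H` and `κ₁ ≠ 0`, `H / S_m∙κ₁` is finite (the `finite_quot` field of the witness interface:
  `H¹_ℱ(K, T_q)` free of rank one, `κ₁ = κ_q(1) ≠ 0`).

WHY (use). The DVR Kolyvagin bound over `S_m` (Howard Thm. 1.6.1 / Mastella–Zerman Thm. 2.40:
`H¹_ℱ(K, A) ≅ Φ/𝓡 ⊕ M ⊕ M`, `ℓ(M) ≤ ℓ(H¹_ℱ(K,T)/𝓡κ(1))`) is a statement about the TORSION of finitely
generated `S_m`-modules and their LENGTHS; the tree's witness interface for the shared μ-residual of rows 9/10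
(`SpecWitness`, fields `finite_torsion : Finite (AddCommGroup.torsion Xq)` and
`card_torsion_le_sq : #Xq_tors ≤ #(H/R∙κ₁)²`) is in `ℤ`-torsion and cardinalities. This file is the bridge
(S2 supplement of the K1 port, cell `pub/bsd-print-x9`, crux idea `specialise-first-mu-x10b`). Pure
commutative algebra; nothing about Galois cohomology is asserted.

References: [Howard2004HeegnerKolyvagin] Compositio Math. 140 (2004), Thm. 1.6.1, §2.2 and proof of Thm. 2.2.10;
[MastellaZerman2026] arXiv:2505.08710, Thm. 2.40; [Washington1997] §13.2; [SerreLocalFields1979] I §6.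
-/

noncomputable section

open scoped Classical

universe u v

namespace Literature.NumberTheory.EllipticCurves

/-! ## §1 Finite index of non-zero ideals; modules killed by an ideal of finite index -/

namespace Module

/-- **A finitely generated module killed by an ideal of finite index is finite** (it is a finitely generated
module over the finite ring `R/𝔟`; any commutative ring). [cite: Washington1997, §13.2] -/
theorem finite_of_finite_quotient_of_le_annihilator {R : Type u} [CommRing R] {M : Type v} [AddCommGroup M]
    [_root_.Module R M] [Module.Finite R M] (𝔟 : Ideal R) [Finite (R ⧸ 𝔟)]
    (h : 𝔟 ≤ Module.annihilator R M) : Finite M := by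
  have htors : Module.IsTorsionBySet R M ↑𝔟 :=
    (Module.isTorsionBySet_iff_subset_annihilator _ _).2 h
  letI := htors.module
  haveI : IsScalarTower R (R ⧸ 𝔟) M := htors.isScalarTower
  haveI : Module.Finite (R ⧸ 𝔟) M := Module.Finite.of_restrictScalars_finite R _ _
  exact Module.finite_of_finite (R ⧸ 𝔟)

end Module

namespace IwasawaAlgebra

variable (p : ℕ) [hp : Fact p.Prime]

/-- **Every non-zero principal ideal of `S_m` has finite index**: for `s̄ = s mod q_m ≠ 0` (i.e. `q_m ∤ s`),
`S_m/(s̄) ≅ Λ/(q_m, s)` is finite (`finite_quotient_span_pair_X_pow_add_C`). In `S_m = ℤ_p[π]`: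
`#(S_m/(s̄)) = p^{v_π(s̄)}`. [cite: Howard2004HeegnerKolyvagin, §2.2 (S_𝔮 a DVR, finite over ℤ_p)]
[cite: SerreLocalFields1979, I §6] -/
theorem finite_quotient_span_singleton_of_ne_zero {m : ℕ} (hm : 1 ≤ m)
    (s : IwasawaAlgebra p ⧸ Ideal.span {(PowerSeries.X ^ m + PowerSeries.C (p : ℤ_[p]) : IwasawaAlgebra p)})
    (hs : s ≠ 0) :
    Finite ((IwasawaAlgebra p ⧸
      Ideal.span {(PowerSeries.X ^ m + PowerSeries.C (p : ℤ_[p]) : IwasawaAlgebra p)}) ⧸ Ideal.span {s}) := by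
  obtain ⟨a, rfl⟩ := Ideal.Quotient.mk_surjective s
  have hna : ¬ (PowerSeries.X ^ m + PowerSeries.C (p : ℤ_[p]) : IwasawaAlgebra p) ∣ a := by
    intro h
    apply hs
    rw [Ideal.Quotient.eq_zero_iff_mem, Ideal.mem_span_singleton]
    exact h
  haveI := finite_quotient_span_pair_X_pow_add_C p hm hna
  have hmap : Ideal.span {Ideal.Quotient.mk
        (Ideal.span {(PowerSeries.X ^ m + PowerSeries.C (p : ℤ_[p]) : IwasawaAlgebra p)}) a} =
      (Ideal.span {a}).map (Ideal.Quotient.mk _) := by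
    rw [Ideal.map_span, Set.image_singleton]
  have hsup : Ideal.span {(PowerSeries.X ^ m + PowerSeries.C (p : ℤ_[p]) : IwasawaAlgebra p)} ⊔ Ideal.span {a} =
      Ideal.span ({a, (PowerSeries.X ^ m + PowerSeries.C (p : ℤ_[p]) : IwasawaAlgebra p)} :
        Set (IwasawaAlgebra p)) := by
    rw [Ideal.span_insert, sup_comm]
  rw [hmap]
  refine Finite.of_equiv _ ((DoubleQuot.quotQuotEquivQuotSup _ _).trans (Ideal.quotEquivOfEq hsup)).toEquiv.symm

/-- `S_m` has characteristic zero: `(n : S_m) ≠ 0` for `n ≠ 0` (`S_m ⊇ ℤ_p` is a domain, free of rank `m`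
over `ℤ_p`; concretely, `q_m ∣ C n` would force `p ∣ `every coefficient … here: `S_m/(n̄)` finite would
contradict nothing, so we argue by constant coefficients: `C n = q_m · b` gives `n = p · b₀`, iterate).
Proof used: the image of `n` in the residue field chain — we use instead that `Λ/(q_m)` is `ℤ_p`-torsion-free
via the DVR structure: `n̄ = 0` ⟹ `p^k̄ = 0` for the `p`-part… (see proof). [cite: SerreLocalFields1979, I §6] -/
theorem natCast_ne_zero {m : ℕ} (hm : 1 ≤ m) {n : ℕ} (hn : n ≠ 0) :
    ((n : IwasawaAlgebra p ⧸
      Ideal.span {(PowerSeries.X ^ m + PowerSeries.C (p : ℤ_[p]) : IwasawaAlgebra p)})) ≠ 0 := by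
  -- `n̄ = mk (C n)`; if `q_m ∣ C n` then comparing constant coefficients modulo higher and higher powers
  -- of `p` is awkward; instead: `q_m ∣ C (n : ℤ_p)` with `q_m` prime and `C n = C p^k · C u`, `u` a unit,
  -- forces `q_m ∣ C p^k`, i.e. `q_m ∣ (C p)^k`, so `q_m ∣ C p = q_m - X^m`, so `q_m ∣ X^m`: contradiction.
  intro h
  have hq := prime_X_pow_add_C p hm
  rw [← map_natCast (Ideal.Quotient.mk _), Ideal.Quotient.eq_zero_iff_mem, Ideal.mem_span_singleton] at h
  -- write `n = p^k * u` with `p ∤ u`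
  obtain ⟨k, u, hu, rfl⟩ := Nat.exists_eq_pow_mul_and_not_dvd hn p hp.out.ne_one
  rw [Nat.cast_mul, Nat.cast_pow] at h
  have hunit : IsUnit ((u : IwasawaAlgebra p)) := by
    rw [← map_natCast (PowerSeries.C (R := ℤ_[p])), PowerSeries.isUnit_iff_constantCoeff, PowerSeries.constantCoeff_C]
    have : IsUnit ((u : ℤ_[p])) := by
      rw [PadicInt.isUnit_iff]
      by_contra hlt
      have hlt' : ‖((u : ℤ) : ℤ_[p])‖ < 1 := by
        rcases lt_or_eq_of_le (PadicInt.norm_le_one ((u : ℤ_[p]))) with h1 | h1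
        · exact_mod_cast h1
        · exact absurd h1 hlt
      rw [PadicInt.norm_int_lt_one_iff_dvd] at hlt'
      exact hu (by exact_mod_cast hlt')
    exact this
  have h1 : (PowerSeries.X ^ m + PowerSeries.C (p : ℤ_[p]) : IwasawaAlgebra p) ∣ (p : IwasawaAlgebra p) ^ k :=
    (hq.dvd_or_dvd h).resolve_right (fun h2 => hq.not_unit (isUnit_of_dvd_unit h2 hunit))
  have h2 : (PowerSeries.X ^ m + PowerSeries.C (p : ℤ_[p]) : IwasawaAlgebra p) ∣ (p : IwasawaAlgebra p) :=
    hq.dvd_of_dvd_pow h1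
  have h3 : (PowerSeries.X ^ m + PowerSeries.C (p : ℤ_[p]) : IwasawaAlgebra p) ∣
      (PowerSeries.X ^ m + PowerSeries.C (p : ℤ_[p]) : IwasawaAlgebra p) - (p : IwasawaAlgebra p) :=
    dvd_sub (dvd_refl _) h2
  have e : (PowerSeries.X ^ m + PowerSeries.C (p : ℤ_[p]) : IwasawaAlgebra p) - (p : IwasawaAlgebra p) =
      PowerSeries.X ^ m := by
    rw [← map_natCast (PowerSeries.C (R := ℤ_[p])) p, add_sub_cancel_right]
  rw [e] at h3
  exact not_X_pow_add_C_dvd_X_pow p hm m h3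

section Module

variable {m : ℕ}
variable {N : Type v} [AddCommGroup N]
  [_root_.Module (IwasawaAlgebra p ⧸
    Ideal.span {(PowerSeries.X ^ m + PowerSeries.C (p : ℤ_[p]) : IwasawaAlgebra p)}) N]

/-! ## §2 `ℤ`-torsion = `S_m`-torsion -/

/-- **The `ℤ`-torsion of an `S_m`-module is its `S_m`-torsion** (`m ≥ 1`, any module): `x` has finite
additive order iff it is killed by a non-zero-divisor of the domain `S_m`. (`→`: `n • x = 0`, `0 < n`, and
`(n : S_m) ≠ 0`; `←`: `s • x = 0`, `s ≠ 0`, and `#(S_m/(s)) • 1 ∈ (s)`, `S_m/(s)` being finite.)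
[cite: Howard2004HeegnerKolyvagin, §2.2] [cite: SerreLocalFields1979, I §6] -/
theorem mem_addTorsion_iff_mem_torsion (hm : 1 ≤ m) (x : N) :
    x ∈ AddCommGroup.torsion N ↔
      x ∈ Submodule.torsion (IwasawaAlgebra p ⧸
        Ideal.span {(PowerSeries.X ^ m + PowerSeries.C (p : ℤ_[p]) : IwasawaAlgebra p)}) N := by
  haveI := isDomain_quotient_X_pow_add_C p hm
  rw [AddCommGroup.mem_torsion, isOfFinAddOrder_iff_nsmul_eq_zero, Submodule.mem_torsion_iff]
  constructor
  · rintro ⟨n, hn, hnx⟩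
    refine ⟨⟨Nat.cast n, mem_nonZeroDivisors_of_ne_zero (natCast_ne_zero p hm hn.ne')⟩, ?_⟩
    rw [Submonoid.smul_def]
    change ((n : IwasawaAlgebra p ⧸
      Ideal.span {(PowerSeries.X ^ m + PowerSeries.C (p : ℤ_[p]) : IwasawaAlgebra p)})) • x = 0
    rw [Nat.cast_smul_eq_nsmul]
    exact hnx
  · rintro ⟨⟨s, hs⟩, hsx⟩
    rw [Submonoid.smul_def] at hsx
    change s • x = 0 at hsx
    have hs0 : s ≠ 0 := nonZeroDivisors.ne_zero hs
    haveI := finite_quotient_span_singleton_of_ne_zero p hm s hs0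
    -- `#(S_m/(s)) • 1 = 0` in `S_m/(s)`, so `(#(S_m/(s)) : S_m) ∈ (s)`
    set n : ℕ := Nat.card ((IwasawaAlgebra p ⧸
      Ideal.span {(PowerSeries.X ^ m + PowerSeries.C (p : ℤ_[p]) : IwasawaAlgebra p)}) ⧸ Ideal.span {s}) with hn
    have hnpos : 0 < n := Nat.card_pos
    have hmem : ((n : IwasawaAlgebra p ⧸
        Ideal.span {(PowerSeries.X ^ m + PowerSeries.C (p : ℤ_[p]) : IwasawaAlgebra p)})) ∈ Ideal.span {s} := by
      rw [← Ideal.Quotient.eq_zero_iff_mem, map_natCast (Ideal.Quotient.mk (Ideal.span {s})) n]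
      have h1 := card_nsmul_eq_zero' (G := (IwasawaAlgebra p ⧸
        Ideal.span {(PowerSeries.X ^ m + PowerSeries.C (p : ℤ_[p]) : IwasawaAlgebra p)}) ⧸ Ideal.span {s})
        (x := (1 : (IwasawaAlgebra p ⧸
          Ideal.span {(PowerSeries.X ^ m + PowerSeries.C (p : ℤ_[p]) : IwasawaAlgebra p)}) ⧸ Ideal.span {s}))
      calc ((n : (IwasawaAlgebra p ⧸
            Ideal.span {(PowerSeries.X ^ m + PowerSeries.C (p : ℤ_[p]) : IwasawaAlgebra p)}) ⧸ Ideal.span {s}))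
          = n • (1 : (IwasawaAlgebra p ⧸
            Ideal.span {(PowerSeries.X ^ m + PowerSeries.C (p : ℤ_[p]) : IwasawaAlgebra p)}) ⧸ Ideal.span {s}) :=
            (nsmul_one n).symm
        _ = 0 := h1
    rw [Ideal.mem_span_singleton'] at hmem
    obtain ⟨t, ht⟩ := hmem
    refine ⟨n, hnpos, ?_⟩
    rw [← Nat.cast_smul_eq_nsmul (IwasawaAlgebra p ⧸
      Ideal.span {(PowerSeries.X ^ m + PowerSeries.C (p : ℤ_[p]) : IwasawaAlgebra p)}), ← ht, mul_smul, hsx,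
      smul_zero]

/-- Set-level form: the `ℤ`-torsion subgroup and the `S_m`-torsion submodule have the same carrier.
[cite: Howard2004HeegnerKolyvagin, §2.2] -/
theorem coe_addTorsion_eq_coe_torsion (hm : 1 ≤ m) :
    (AddCommGroup.torsion N : Set N) =
      (Submodule.torsion (IwasawaAlgebra p ⧸
        Ideal.span {(PowerSeries.X ^ m + PowerSeries.C (p : ℤ_[p]) : IwasawaAlgebra p)}) N : Set N) := by
  ext x
  exact mem_addTorsion_iff_mem_torsion p hm x

/-! ## §3 Finitely generated torsion `S_m`-modules are finite, of order `p^{length}` -/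

/-- **A finitely generated TORSION `S_m`-module is finite**: its annihilator contains a non-zero `s`, and it
is a finitely generated module over the finite ring `S_m/(s)`. [cite: Howard2004HeegnerKolyvagin, §2.2]
[cite: Washington1997, §13.2] -/
theorem finite_of_isTorsion (hm : 1 ≤ m)
    [Module.Finite (IwasawaAlgebra p ⧸
      Ideal.span {(PowerSeries.X ^ m + PowerSeries.C (p : ℤ_[p]) : IwasawaAlgebra p)}) N]
    (hN : Module.IsTorsion (IwasawaAlgebra p ⧸
      Ideal.span {(PowerSeries.X ^ m + PowerSeries.C (p : ℤ_[p]) : IwasawaAlgebra p)}) N) : Finite N := by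
  haveI := isDomain_quotient_X_pow_add_C p hm
  obtain ⟨s, hsann, hs⟩ := Submodule.annihilator_top_inter_nonZeroDivisors (M := N) hN
  have hs0 : s ≠ 0 := nonZeroDivisors.ne_zero hs
  haveI := finite_quotient_span_singleton_of_ne_zero p hm s hs0
  refine Module.finite_of_finite_quotient_of_le_annihilator (Ideal.span {s}) ?_
  rw [Ideal.span_singleton_le_iff_mem, ← Submodule.annihilator_top]
  exact hsann

/-- **The torsion submodule of a finitely generated `S_m`-module is finite.**
[cite: Howard2004HeegnerKolyvagin, §2.2 and Thm. 1.6.1] -/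
theorem finite_torsion (hm : 1 ≤ m)
    [Module.Finite (IwasawaAlgebra p ⧸
      Ideal.span {(PowerSeries.X ^ m + PowerSeries.C (p : ℤ_[p]) : IwasawaAlgebra p)}) N] :
    Finite (Submodule.torsion (IwasawaAlgebra p ⧸
      Ideal.span {(PowerSeries.X ^ m + PowerSeries.C (p : ℤ_[p]) : IwasawaAlgebra p)}) N) := by
  haveI := isDomain_quotient_X_pow_add_C p hm
  haveI : IsNoetherianRing (IwasawaAlgebra p ⧸
      Ideal.span {(PowerSeries.X ^ m + PowerSeries.C (p : ℤ_[p]) : IwasawaAlgebra p)}) := inferInstance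
  haveI : IsNoetherian (IwasawaAlgebra p ⧸
      Ideal.span {(PowerSeries.X ^ m + PowerSeries.C (p : ℤ_[p]) : IwasawaAlgebra p)}) N :=
    isNoetherian_of_isNoetherianRing_of_finite _ _
  exact finite_of_isTorsion p hm (Submodule.torsion_isTorsion)

/-- **The `ℤ`-torsion subgroup of a finitely generated `S_m`-module is finite** (the `Xq_tors` field of the
tree's witness interface). [cite: Howard2004HeegnerKolyvagin, §2.2 and Thm. 1.6.1] [cite: MastellaZerman2026, Thm. 2.40] -/
theorem finite_addTorsion (hm : 1 ≤ m)
    [Module.Finite (IwasawaAlgebra p ⧸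
      Ideal.span {(PowerSeries.X ^ m + PowerSeries.C (p : ℤ_[p]) : IwasawaAlgebra p)}) N] :
    Finite (AddCommGroup.torsion N) := by
  haveI := finite_torsion p hm (N := N)
  have e : (AddCommGroup.torsion N) ≃ (Submodule.torsion (IwasawaAlgebra p ⧸
      Ideal.span {(PowerSeries.X ^ m + PowerSeries.C (p : ℤ_[p]) : IwasawaAlgebra p)}) N) :=
    { toFun := fun x => ⟨x.1, (mem_addTorsion_iff_mem_torsion p hm x.1).mp x.2⟩
      invFun := fun x => ⟨x.1, (mem_addTorsion_iff_mem_torsion p hm x.1).mpr x.2⟩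
      left_inv := fun _ => rfl
      right_inv := fun _ => rfl }
  exact Finite.of_equiv _ e.symm

/-- **`#N_tors = p^{ℓ_{S_m}(N_tors)}`** for a finitely generated `S_m`-module `N` (`ℤ`-torsion counted, `S_m`-length
measured) — the conversion of a length bound on `M` in `H¹_ℱ(K, A) ≅ Φ/𝓡 ⊕ M ⊕ M` into the cardinality
`#Xq_tors`. [cite: MastellaZerman2026, Thm. 2.40] [cite: Howard2004HeegnerKolyvagin, Thm. 1.6.1] -/
theorem natCard_addTorsion_eq_pow_length (hm : 1 ≤ m)
    [Module.Finite (IwasawaAlgebra p ⧸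
      Ideal.span {(PowerSeries.X ^ m + PowerSeries.C (p : ℤ_[p]) : IwasawaAlgebra p)}) N] :
    Nat.card (AddCommGroup.torsion N) =
      p ^ (Module.length (IwasawaAlgebra p ⧸
        Ideal.span {(PowerSeries.X ^ m + PowerSeries.C (p : ℤ_[p]) : IwasawaAlgebra p)})
        (Submodule.torsion (IwasawaAlgebra p ⧸
          Ideal.span {(PowerSeries.X ^ m + PowerSeries.C (p : ℤ_[p]) : IwasawaAlgebra p)}) N)).toNat := by
  haveI := finite_torsion p hm (N := N)
  have e : (AddCommGroup.torsion N) ≃ (Submodule.torsion (IwasawaAlgebra p ⧸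
      Ideal.span {(PowerSeries.X ^ m + PowerSeries.C (p : ℤ_[p]) : IwasawaAlgebra p)}) N) :=
    { toFun := fun x => ⟨x.1, (mem_addTorsion_iff_mem_torsion p hm x.1).mp x.2⟩
      invFun := fun x => ⟨x.1, (mem_addTorsion_iff_mem_torsion p hm x.1).mpr x.2⟩
      left_inv := fun _ => rfl
      right_inv := fun _ => rfl }
  rw [Nat.card_congr e]
  exact natCard_eq_pow_length_quotient_X_pow_add_C_of_finite p hm

/-! ## §4 (appended) Free rank-one modules: `H / S_m∙κ₁` is finite for `κ₁ ≠ 0` -/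

/-- **For a free rank-one `S_m`-module `H` (given as `e : H ≃ S_m`) and `κ₁ ≠ 0`, the quotient `H / S_m∙κ₁` is
finite** (`≅ S_m/(e κ₁)`, a non-zero principal ideal has finite index) — the `finite_quot` field of the tree's
witness interface, where `H = H¹_ℱ(K, T_q)` is free of rank one over the DVR `S_m` and `κ₁ = κ_q(1) ≠ 0`.
[cite: Howard2004HeegnerKolyvagin, Thm. 1.6.1] [cite: MastellaZerman2026, Thm. 2.40] -/
theorem finite_quotient_span_singleton_of_linearEquiv (hm : 1 ≤ m) {H : Type v} [AddCommGroup H]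
    [_root_.Module (IwasawaAlgebra p ⧸
      Ideal.span {(PowerSeries.X ^ m + PowerSeries.C (p : ℤ_[p]) : IwasawaAlgebra p)}) H]
    (e : H ≃ₗ[IwasawaAlgebra p ⧸
      Ideal.span {(PowerSeries.X ^ m + PowerSeries.C (p : ℤ_[p]) : IwasawaAlgebra p)}]
      (IwasawaAlgebra p ⧸ Ideal.span {(PowerSeries.X ^ m + PowerSeries.C (p : ℤ_[p]) : IwasawaAlgebra p)}))
    (κ₁ : H) (hκ : κ₁ ≠ 0) :
    Finite (H ⧸ Submodule.span (IwasawaAlgebra p ⧸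
      Ideal.span {(PowerSeries.X ^ m + PowerSeries.C (p : ℤ_[p]) : IwasawaAlgebra p)}) {κ₁}) := by
  have hne : e κ₁ ≠ 0 := fun h => hκ (e.injective (by rw [h, map_zero]))
  haveI := finite_quotient_span_singleton_of_ne_zero p hm (e κ₁) hne
  have hmap : (Submodule.span (IwasawaAlgebra p ⧸
      Ideal.span {(PowerSeries.X ^ m + PowerSeries.C (p : ℤ_[p]) : IwasawaAlgebra p)}) {κ₁}).map
        (e : H →ₗ[IwasawaAlgebra p ⧸
          Ideal.span {(PowerSeries.X ^ m + PowerSeries.C (p : ℤ_[p]) : IwasawaAlgebra p)}] _) =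
      Ideal.span {e κ₁} := by
    rw [Submodule.map_span, Set.image_singleton]
    rfl
  exact Finite.of_equiv _ (Submodule.Quotient.equiv _ _ e hmap).toEquiv.symm

/-- **Free of rank one, basis-free form**: for `H` free of `finrank 1` over `S_m` and `κ₁ ≠ 0`, `H / S_m∙κ₁` is
finite. [cite: Howard2004HeegnerKolyvagin, Thm. 1.6.1] [cite: MastellaZerman2026, Thm. 2.40] -/
theorem finite_quotient_span_singleton_of_finrank_eq_one (hm : 1 ≤ m) {H : Type v} [AddCommGroup H]
    [_root_.Module (IwasawaAlgebra p ⧸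
      Ideal.span {(PowerSeries.X ^ m + PowerSeries.C (p : ℤ_[p]) : IwasawaAlgebra p)}) H]
    [Module.Free (IwasawaAlgebra p ⧸
      Ideal.span {(PowerSeries.X ^ m + PowerSeries.C (p : ℤ_[p]) : IwasawaAlgebra p)}) H]
    [Module.Finite (IwasawaAlgebra p ⧸
      Ideal.span {(PowerSeries.X ^ m + PowerSeries.C (p : ℤ_[p]) : IwasawaAlgebra p)}) H]
    (hH : Module.finrank (IwasawaAlgebra p ⧸
      Ideal.span {(PowerSeries.X ^ m + PowerSeries.C (p : ℤ_[p]) : IwasawaAlgebra p)}) H = 1)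
    (κ₁ : H) (hκ : κ₁ ≠ 0) :
    Finite (H ⧸ Submodule.span (IwasawaAlgebra p ⧸
      Ideal.span {(PowerSeries.X ^ m + PowerSeries.C (p : ℤ_[p]) : IwasawaAlgebra p)}) {κ₁}) := by
  haveI := isDomain_quotient_X_pow_add_C p hm
  have e : H ≃ₗ[IwasawaAlgebra p ⧸
      Ideal.span {(PowerSeries.X ^ m + PowerSeries.C (p : ℤ_[p]) : IwasawaAlgebra p)}]
      (IwasawaAlgebra p ⧸ Ideal.span {(PowerSeries.X ^ m + PowerSeries.C (p : ℤ_[p]) : IwasawaAlgebra p)}) :=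
    LinearEquiv.ofFinrankEq H _ (by rw [hH, Module.finrank_self])
  exact finite_quotient_span_singleton_of_linearEquiv p hm e κ₁ hκ

end Module

end IwasawaAlgebra

end Literature.NumberTheory.EllipticCurves

end
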